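import Mathlib
import Literature.MathematicalPhysics.QuantumLattice.GrassmannIntegral
import Literature.Barriers.QuantumFields.WilsonDeterminantSign
import Summits.QuantumFields.QCD.Theorems.PauliWegnerSeaPhaseQuenchedFlavourDecayNoCompactWilsonMode

/-!
# Stub `stub_wilsonKernelFinrankLe` of line `crossing-split-integrability`
(crux `Summit.QuantumFields.QCD.Theses.PauliWegnerSea.PhaseQuenchedFlavourDecay`, item stmt-QuantumFields-9151)

**No flat Wilson bands — for ANY gauge field.**

Let `D_W = wilsonDirac ρ U m 1` be the tree's `r = 1` Wilson–Dirac matrix on the torus `(ℤ/L)⁴`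
(any group `G`, any matrix representation `ρ : G → M_N(ℂ)`, any configuration `U`, any real mass
`m`) and let `V` be ANY site-diagonal operator (`V x` an arbitrary colour–spin matrix at each site:
twisted mass `−E γ₅`, chemical potential, clover term, random on-site potential, …).  Then

  `dim_ℂ ker (D_W + V) ≤ 16 · N · L³ = o(L⁴)`  (`stub_wilsonKernelFinrankLe`),

i.e. no eigenvalue of `D_W + V` carries a positive fraction of the `4 N L⁴` states, uniformly in
the background.  This is the finite-volume "no flat band" input of the Delyon–Souillard argument
(the integrated density of states of such operators has no atoms).

Proof (Delyon–Souillard dimension count on the landed no-compacton theorem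
`stub_noCompactWilsonMode`).  Let `Z` be the union of the four coordinate layers
`{x 0 = 0}, {x 0 = 1}, {x 1 = 0}, {x 1 = 1}`.  The restriction map `ψ ↦ ψ|_{Z × colour × spin}`
is injective on `ker (D_W + V)`: if `ψ` in the kernel vanishes on `Z`, then at every site `x`
where `ψ(x, ·, ·) = 0` the site-diagonal term `(V ψ)(x) = V x · ψ(x) = 0` vanishes, hence so does
`(D_W ψ)(x) = −(V ψ)(x)`, and `stub_noCompactWilsonMode` (directions `μ = 0 ≠ ν = 1`, window
`a = b = 0`) gives `ψ = 0`.  Therefore `dim ker ≤ |Z| · N · 4 ≤ 4 L³ · 4 N = 16 N L³`, each layer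
`{x i = a}` injecting into `Fin 3 → ZMod L` by deleting the `i`-th coordinate.
-/

namespace Summit.QuantumFields.QCD.Cruxes.PhaseQuenchedFlavourDecay.CrossingSplitIntegrability

open Literature.MathematicalPhysics.QuantumFieldTheory Literature.MathematicalPhysics.QuantumLattice
  Literature.Probability.LatticeModels

/-- A coordinate layer `{x | x i = a}` of the torus `(ℤ/L)⁴` has at most `L³` sites: deleting the
`i`-th coordinate, `x ↦ x ∘ Fin.succAbove i`, is injective on the layer. -/
theorem card_torusLayer_le {L : ℕ} [NeZero L] (i : Fin 4) (a : ZMod L) :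
    Fintype.card {x : TorusSite 4 L // x i = a} ≤ L ^ 3 := by
  classical
  have h := Fintype.card_le_of_injective
    (fun x : {x : TorusSite 4 L // x i = a} => fun j : Fin 3 => x.1 (Fin.succAbove i j)) ?_
  · rwa [Fintype.card_fun, ZMod.card, Fintype.card_fin] at h
  · rintro ⟨x, hx⟩ ⟨y, hy⟩ hxy
    refine Subtype.ext (funext fun k => ?_)
    change x k = y k
    by_cases hk : k = i
    · subst hk
      rw [hx, hy]
    · obtain ⟨j, rfl⟩ := Fin.exists_succAbove_eq hk
      exact congrFun hxy j

/-- The union of the four layers `x 0 ∈ {0, 1}`, `x 1 ∈ {0, 1}` of the torus `(ℤ/L)⁴` has at most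
`4 L³` sites. -/
theorem card_fourTorusLayers_le {L : ℕ} [NeZero L] :
    Fintype.card {x : TorusSite 4 L // x 0 = 0 ∨ x 0 = 1 ∨ x 1 = 0 ∨ x 1 = 1} ≤ 4 * L ^ 3 := by
  classical
  have h1 := Fintype.card_subtype_or (fun x : TorusSite 4 L => x 0 = 0)
    (fun x => x 0 = 1 ∨ x 1 = 0 ∨ x 1 = 1)
  have h2 := Fintype.card_subtype_or (fun x : TorusSite 4 L => x 0 = 1) (fun x => x 1 = 0 ∨ x 1 = 1)
  have h3 := Fintype.card_subtype_or (fun x : TorusSite 4 L => x 1 = 0) (fun x => x 1 = 1)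
  have c1 := card_torusLayer_le (L := L) 0 0
  have c2 := card_torusLayer_le (L := L) 0 1
  have c3 := card_torusLayer_le (L := L) 1 0
  have c4 := card_torusLayer_le (L := L) 1 1
  omega

/-- **`stub_wilsonKernelFinrankLe`** — no flat Wilson bands: for every `L, N, G, ρ, U, m` and every
site-diagonal colour–spin potential `V`, `dim_ℂ ker (D_W + V) ≤ 16 N L³`
(`D_W = wilsonDirac ρ U m 1`).  Delyon–Souillard dimension counting on top of
`stub_noCompactWilsonMode`: a kernel vector is determined by its restriction to the four layers
`x 0 ∈ {0,1}`, `x 1 ∈ {0,1}`. -/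
theorem stub_wilsonKernelFinrankLe :
    ∀ (L N : ℕ) [NeZero L] (G : Type) [Group G] (ρ : G →* Matrix (Fin N) (Fin N) ℂ)
      (U : GaugeConfig 4 L G) (m : ℝ) (V : TorusSite 4 L → Matrix (Fin N × Fin 4) (Fin N × Fin 4) ℂ),
      Module.finrank ℂ (LinearMap.ker (Matrix.toLin' (wilsonDirac ρ U m 1 +
        Matrix.of fun p q : TorusSite 4 L × Fin N × Fin 4 => if p.1 = q.1 then V p.1 p.2 q.2 else 0))) ≤
        16 * N * L ^ 3 := by
  intro L N _ G _ ρ U m V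
  classical
  -- restriction to the four layers is injective on the kernel
  have hinj : Function.Injective
      ((LinearMap.funLeft ℂ ℂ
          (fun p : {x : TorusSite 4 L // x 0 = 0 ∨ x 0 = 1 ∨ x 1 = 0 ∨ x 1 = 1} × Fin N × Fin 4 =>
            ((p.1 : TorusSite 4 L), p.2))) ∘ₗ
        (LinearMap.ker (Matrix.toLin' (wilsonDirac ρ U m 1 +
          Matrix.of fun p q : TorusSite 4 L × Fin N × Fin 4 =>
            if p.1 = q.1 then V p.1 p.2 q.2 else 0))).subtype) := by
    refine (injective_iff_map_eq_zero _).2 fun ψ hRψ => ?_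
    obtain ⟨ψ, hψ⟩ := ψ
    have hA := LinearMap.mem_ker.mp hψ
    rw [Matrix.toLin'_apply, Matrix.add_mulVec] at hA
    -- `ψ` vanishes on the four layers
    have hZ : ∀ x : TorusSite 4 L, (x 0 = 0 ∨ x 0 = 0 + 1 ∨ x 1 = 0 ∨ x 1 = 0 + 1) →
        ∀ (c : Fin N) (s : Fin 4), ψ (x, c, s) = 0 := by
      intro x hx c s
      rw [zero_add] at hx
      exact congrFun hRψ (⟨x, hx⟩, c, s)
    -- `D_W ψ` vanishes wherever `ψ` does (the `V`-term is site-diagonal)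
    have hD : ∀ x : TorusSite 4 L, (∀ (c : Fin N) (s : Fin 4), ψ (x, c, s) = 0) →
        ∀ (c : Fin N) (s : Fin 4), Matrix.mulVec (wilsonDirac ρ U m 1) ψ (x, c, s) = 0 := by
      intro x hx c s
      have h1 := congrFun hA (x, c, s)
      rw [Pi.add_apply, Pi.zero_apply] at h1
      have h2 : Matrix.mulVec (Matrix.of fun p q : TorusSite 4 L × Fin N × Fin 4 =>
          if p.1 = q.1 then V p.1 p.2 q.2 else 0) ψ (x, c, s) = 0 := by
        simp only [Matrix.mulVec, dotProduct, Matrix.of_apply]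
        refine Finset.sum_eq_zero ?_
        rintro ⟨y, c', s'⟩ -
        dsimp only
        split_ifs with h
        · subst h
          rw [hx c' s', mul_zero]
        · exact zero_mul _
      rwa [h2, add_zero] at h1
    have h0 : ψ = 0 := stub_noCompactWilsonMode L N G ρ U m ψ 0 1 0 0 (by decide) hZ hD
    exact Subtype.ext h0
  calc Module.finrank ℂ _
      ≤ Module.finrank ℂ
          ({x : TorusSite 4 L // x 0 = 0 ∨ x 0 = 1 ∨ x 1 = 0 ∨ x 1 = 1} × Fin N × Fin 4 → ℂ) :=
        LinearMap.finrank_le_finrank_of_injective hinj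
    _ = Fintype.card {x : TorusSite 4 L // x 0 = 0 ∨ x 0 = 1 ∨ x 1 = 0 ∨ x 1 = 1} * (N * 4) := by
        rw [Module.finrank_fintype_fun_eq_card, Fintype.card_prod, Fintype.card_prod,
          Fintype.card_fin, Fintype.card_fin]
    _ ≤ 4 * L ^ 3 * (N * 4) := Nat.mul_le_mul_right _ card_fourTorusLayers_le
    _ = 16 * N * L ^ 3 := by ring

/-- **Eigenspaces of the Hermitian Wilson–Dirac operator are thin**: for every `L, N, G, ρ, U, m`
and every `E : ℂ`, `dim_ℂ ker (H_W − E) ≤ 16 N L³` where `H_W = Γ₅ D_W`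
(`hermitianWilsonDirac ρ U m 1`).  Indeed `H_W − E = Γ₅ (D_W − E Γ₅)` with `Γ₅² = 1`, and `−E Γ₅`
is the site-diagonal potential `V x = −E (1_N ⊗ γ₅)`, so `stub_wilsonKernelFinrankLe` applies.  In
particular no eigenvalue of `H_W` (the local zero-mode law of crux NOTES c8 included) carries a
positive fraction of the `4 N L⁴` states, whatever the gauge background. -/
theorem hermitianWilsonDirac_eigenspace_finrank_le :
    ∀ (L N : ℕ) [NeZero L] (G : Type) [Group G] (ρ : G →* Matrix (Fin N) (Fin N) ℂ)
      (U : GaugeConfig 4 L G) (m : ℝ) (E : ℂ),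
      Module.finrank ℂ (LinearMap.ker (Matrix.toLin'
        (Literature.Barriers.QuantumFields.WilsonDeterminant.hermitianWilsonDirac ρ U m 1 -
          E • (1 : Matrix _ _ ℂ)))) ≤ 16 * N * L ^ 3 := by
  intro L N _ G _ ρ U m E
  classical
  -- the site-diagonal, colour-trivial potential `V x = -E γ₅`
  refine le_trans (Submodule.finrank_mono ?_) (stub_wilsonKernelFinrankLe L N G ρ U m
    fun _ => Matrix.diagonal fun cs : Fin N × Fin 4 => -E * (![1, 1, -1, -1] : Fin 4 → ℂ) cs.2)
  -- `-E Γ₅` in the site-diagonal format of `stub_wilsonKernelFinrankLe`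
  have hV : (Matrix.of fun p q : TorusSite 4 L × Fin N × Fin 4 =>
      if p.1 = q.1 then (fun _ : TorusSite 4 L => Matrix.diagonal fun cs : Fin N × Fin 4 =>
        -E * (![1, 1, -1, -1] : Fin 4 → ℂ) cs.2) p.1 p.2 q.2 else 0) =
      -E • (spinorLift gammaFive :
        Matrix (TorusSite 4 L × Fin N × Fin 4) (TorusSite 4 L × Fin N × Fin 4) ℂ) := by
    rw [spinorLift_gammaFive_eq_diagonal]
    ext p q
    simp only [Matrix.of_apply, Matrix.diagonal_apply, Matrix.smul_apply, smul_eq_mul, mul_ite,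
      mul_zero]
    by_cases h1 : p.1 = q.1
    · by_cases h2 : p.2 = q.2
      · rw [if_pos h1, if_pos h2, if_pos (Prod.ext h1 h2)]
      · rw [if_pos h1, if_neg h2, if_neg fun h => h2 (congrArg Prod.snd h)]
    · rw [if_neg h1, if_neg fun h => h1 (congrArg Prod.fst h)]
  -- `H_W - E = Γ₅ (D_W - E Γ₅)`
  have hfac : Literature.Barriers.QuantumFields.WilsonDeterminant.hermitianWilsonDirac ρ U m 1 -
      E • (1 : Matrix _ _ ℂ) =
      spinorLift gammaFive * (wilsonDirac ρ U m 1 +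
        Matrix.of fun p q : TorusSite 4 L × Fin N × Fin 4 =>
          if p.1 = q.1 then (fun _ : TorusSite 4 L => Matrix.diagonal fun cs : Fin N × Fin 4 =>
            -E * (![1, 1, -1, -1] : Fin 4 → ℂ) cs.2) p.1 p.2 q.2 else 0) := by
    rw [hV, Matrix.mul_add, Matrix.mul_smul, spinorLift_gammaFive_mul_self, neg_smul,
      ← sub_eq_add_neg, Literature.Barriers.QuantumFields.WilsonDeterminant.hermitianWilsonDirac]
  intro ψ hψ
  rw [LinearMap.mem_ker, Matrix.toLin'_apply] at hψ ⊢
  rw [hfac, ← Matrix.mulVec_mulVec] at hψ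
  have h := congrArg (Matrix.mulVec (spinorLift gammaFive)) hψ
  rwa [Matrix.mulVec_mulVec, spinorLift_gammaFive_mul_self, Matrix.one_mulVec,
    Matrix.mulVec_zero] at h

end Summit.QuantumFields.QCD.Cruxes.PhaseQuenchedFlavourDecay.CrossingSplitIntegrability
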